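import Summits.NavierStokesRegularity.OSWSelfSimilar.SheetREvenAssemblyOperators
import Summits.NavierStokesRegularity.OSWSelfSimilar.SheetRGeneratorEvenWeak
import Summits.NavierStokesRegularity.OSWSelfSimilar.SheetRTimeShiftModeWeakEigen
import Summits.NavierStokesRegularity.OSWSelfSimilar.SheetRWeakEigenReal
import Summits.NavierStokesRegularity.OSWSelfSimilar.SheetRResolventConj
import Summits.NavierStokesRegularity.OSWSelfSimilar.SheetRSpectrumOddAssemblyReal
import HarnessLib

/-!
# SHEET-ℝ frame, EVEN ZERO-MASS class `E⁺₀`: the even energy-space element `espE` of a profile given in the function language, its complex class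
# in `WcevenZ`, the covariant velocity of a translation mode, and integration by parts against parity-free tests — the read-backs the even
# weak language is written in

HONEST FRAMING (cell ns-blowup GROUP B / zone Z3, case Z3-SR-SPEC EVEN half; 1-D MODEL certificate frame (viscous gCLM/OSW sheet on the line); not Euler/NS;
«violates: none — MODEL»).  Nothing here asserts that a profile exists; no number of record moves.  Even twins of selfsim's `SheetREnergySpaceOf` (`espOf`) /
`SheetRWeakEigenReal` (`cplx`) and of cert-5 g6's `SheetRTimeShiftModeWeak` §§1–2, used by the companion file `SheetRTranslationModeWeakEigen` (cert-5 g9; split by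
the ≤ 400-line rule):
* §1 `integral_deriv_mul_testAny` — `∫ g′φ = −∫ gφ₁` for `g ∈ C¹` and a PARITY-FREE compactly supported energy-class test (`IsCompactTestAny`);
* §2 `exists_espE_of_profile` — an even zero-mass energy-class profile `v = v(0) + ∫₀v₁` (finite weights, `∫ v = 0`) IS an element `P` of selfsim's even
  energy space `EspE L hL` with `profile P = v` (everywhere) and `derE P = v₁` a.e.; `espE_ne_zero_of_apply_ne_zero`;
* §3 `setIntegral_Iic_hilbertTransform_deriv` — THE COVARIANT VELOCITY OF A TRANSLATION MODE: `∫_{(−∞,ξ]} H[Ω′] = HΩ(ξ)` for `Ω ∈ C³ ∩ L¹` in the decay class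
  with `HΩ, H[Ω′] ∈ L¹` (`(HΩ)′ = H[Ω′]`; an `L¹` function with `L¹` derivative tends to `0` at `−∞` — Mathlib `tendsto_zero_of_hasDerivAt_of_integrableOn_Iic`,
  `integral_Iic_of_hasDerivAt_of_tendsto`) — DESIGN-Z3-SR-SPEC-EVEN (D2)'s «the covariant perturbation velocity of `Ω′` is `HΩ`», in the kernel;
* §4 `cplxE P = ιEE P + 0·i`, `realE g = g + 0·i ∈ WcevenZ` (two small definitions with body), `rankOneLiftE_apply` (the real lift `θ⟪h, ιEE ·⟫f`); `⟪a + 0i, b + 0i⟫_ℂ = ⟪a, b⟫_ℝ`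
  is selfsim's `SheetRSpectrumOddAssemblyReal.inner_ofRealW`.
No named fact; no `Prop` hypothesis beyond selfsim's structures.  WHAT THIS IS NOT: not NS; not the spectral certificate.
-/

noncomputable section

namespace Summit.NavierStokesRegularity.OSWSelfSimilar
namespace SheetREvenEnergySpaceOf

open _root_.MeasureTheory _root_.Set _root_.Filter _root_.Real Literature.Analysis.Fourier SheetRWeakProfilePV SheetRWeakToStrong
  SheetREnergyClass SheetRWeightedMeasure SheetRWeightedEmbeddings SheetREnergySpace SheetRLinearisedTests SheetRTestSpace
  SheetRLinearisedFormBounds SheetRSolutionOperator SheetRPerturbedSolutionOperator SheetRComplexPivot SheetRResolventConj SheetRAssemblyOperators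
  SheetRCertificateAssembly SheetREvenTests SheetREvenEnergySpace SheetREvenForms SheetREvenPairUniqueness SheetREvenClass
  SheetRResolventEvenClass SheetRGeneratorEvenWeak SheetREvenEnergyClass SheetREvenAssemblyOperators SheetRTimeShiftModeWeak
  SheetRTimeShiftModeWeakEigen SheetRWeakEigenReal SheetRSpectrumOddAssemblyReal
open scoped Topology ENNReal ContDiff InnerProductSpace ComplexConjugate

/-! ### §1 Integration by parts against a parity-free compactly supported test -/

/-- **`∫ g′·φ = −∫ g·φ₁`** for `g ∈ C¹` and a compactly supported PARITY-FREE energy-class test `(φ, φ₁)` (`φ = φ(0) + ∫₀φ₁` absolutely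
continuous, `φ′ = φ₁` a.e., boundary terms vanish). [folklore] -/
theorem integral_deriv_mul_testAny {g φ φ₁ : ℝ → ℝ} (hg : ContDiff ℝ 1 g) (hφ : IsCompactTestAny φ φ₁) :
    ∫ y, deriv g y * φ y = -∫ y, g y * φ₁ y := by
  obtain ⟨hc, -, -, -⟩ := basic_of_any hφ
  obtain ⟨R, hR⟩ := hφ.support
  have hii : ∀ a b, IntervalIntegrable φ₁ volume a b := intervalIntegrable_of_memLp_two hφ.memLp
  set R' : ℝ := |R| + 1 with hR'
  have hR'pos : 0 < R' := by positivity
  have hvan : ∀ x, R' ≤ |x| → φ x = 0 ∧ φ₁ x = 0 := fun x hx => hR x (by linarith [le_abs_self R])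
  have hφac : AbsolutelyContinuousOnInterval φ (-R') R' := absolutelyContinuousOnInterval_of_primitive hφ.primitive hii _ _
  have hgac : AbsolutelyContinuousOnInterval g (-R') R' := hg.contDiffOn.absolutelyContinuousOnInterval
  have hibp := hgac.integral_mul_deriv_eq_deriv_mul hφac
  have hva : φ (-R') = 0 := (hvan _ (by rw [abs_neg, abs_of_pos hR'pos])).1
  have hvb : φ R' = 0 := (hvan _ (by rw [abs_of_pos hR'pos])).1
  simp only [hva, hvb, mul_zero, sub_zero, zero_sub] at hibp
  have hder : ∀ᵐ y : ℝ, HasDerivAt φ (φ₁ y) y := by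
    filter_upwards [_root_.LocallyIntegrable.ae_hasDerivAt_integral (hφ.memLp.locallyIntegrable one_le_two)] with y hy
    have e : φ = fun x => φ 0 + ∫ s in (0 : ℝ)..x, φ₁ s := funext hφ.primitive
    rw [e]
    exact (hy 0).const_add _
  have hcongr : ∫ y in (-R')..R', g y * deriv φ y = ∫ y in (-R')..R', g y * φ₁ y :=
    intervalIntegral.integral_congr_ae (hder.mono fun y hy _ => by rw [hy.deriv])
  have hout : ∀ y, y ∉ Ioc (-R') R' → R' ≤ |y| := by
    intro y hy
    simp only [mem_Ioc, not_and_or, not_lt, not_le] at hy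
    rcases hy with h | h
    · rw [abs_of_nonpos (by linarith)]; linarith
    · rw [abs_of_pos (by linarith)]; exact h.le
  have hsupp1 : Function.support (fun y => deriv g y * φ y) ⊆ Ioc (-R') R' := by
    intro y hy
    rw [Function.mem_support] at hy
    by_contra hy'
    exact hy (by rw [(hvan y (hout y hy')).1, mul_zero])
  have hsupp2 : Function.support (fun y => g y * φ₁ y) ⊆ Ioc (-R') R' := by
    intro y hy
    rw [Function.mem_support] at hy
    by_contra hy'
    exact hy (by rw [(hvan y (hout y hy')).2, mul_zero])
  rw [← intervalIntegral.integral_eq_integral_of_support_subset hsupp1,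
    ← intervalIntegral.integral_eq_integral_of_support_subset hsupp2, ← hcongr]
  linarith

/-! ### §2 Even zero-mass energy-class profiles as elements of `EspE` -/

variable {L : ℝ}

/-- **An even zero-mass energy-class profile is an element of `E⁺₀`.** For `v = v(0) + ∫₀v₁` even with `v₁` a.e.-strongly measurable,
`∫ w v² < ∞`, `∫ w v₁² < ∞` and `∫ v = 0` there is `P ∈ EspE L hL` with `profile P = v` (everywhere) and `derE P = v₁` a.e. [folklore] -/
theorem exists_espE_of_profile (hL : 0 < L) {v v₁ : ℝ → ℝ} (hv : ∀ x, v x = v 0 + ∫ s in (0 : ℝ)..x, v₁ s)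
    (heven : ∀ y, v (-y) = v y) (hv₁m : AEStronglyMeasurable v₁ volume)
    (hw0 : Integrable fun y => (L ^ 2 + y ^ 2) * v y ^ 2) (hw1 : Integrable fun y => (L ^ 2 + y ^ 2) * v₁ y ^ 2)
    (hz : ∫ y, v y = 0) :
    ∃ P : EspE L hL, profile P = v ∧ derE P =ᵐ[volume] v₁ := by
  have hv₁2 : MemLp v₁ 2 volume := memLp_two_of_weighted_sq hL hv₁m hw1
  have hvc : Continuous v := continuous_of_primitive hv (intervalIntegrable_of_memLp_two hv₁2)
  set a : W L := (memLp_W hvc.aestronglyMeasurable hw0).toLp v with ha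
  set b : W L := (memLp_W hv₁m hw1).toLp v₁ with hb
  have hae_a : (a : ℝ → ℝ) =ᵐ[volume] v := ae_volume_of_ae_μw hL (MemLp.coeFn_toLp _)
  have hae_b : (b : ℝ → ℝ) =ᵐ[volume] v₁ := ae_volume_of_ae_μw hL (MemLp.coeFn_toLp _)
  have hprimb : ∀ x, prim (b : ℝ → ℝ) x = v x - v 0 := fun x => by
    rw [prim_congr_ae hae_b, prim_apply, hv x]; ring
  have hfst : ((WithLp.toLp 2 (((1 / 2 : ℝ) • a), b)).fst : ℝ → ℝ) =ᵐ[volume] fun y => (1 / 2) * v y := by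
    have h1 : (((1 / 2 : ℝ) • a : W L) : ℝ → ℝ) =ᵐ[volume] fun y => (1 / 2) * (a : ℝ → ℝ) y :=
      (ae_volume_of_ae_μw hL (Lp.coeFn_smul (1 / 2 : ℝ) a)).mono fun y hy => by rw [hy, Pi.smul_apply, smul_eq_mul]
    exact h1.trans (hae_a.mono fun y hy => by simp only [hy])
  have hsnd : (WithLp.toLp 2 (((1 / 2 : ℝ) • a), b)).snd = b := rfl
  have hI : ∀ x, ∫ s in (0 : ℝ)..x, (2 * ((WithLp.toLp 2 (((1 / 2 : ℝ) • a), b)).fst : ℝ → ℝ) s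
      - prim (((WithLp.toLp 2 (((1 / 2 : ℝ) • a), b)).snd : W L) : ℝ → ℝ) s) = x * v 0 := by
    intro x
    have hcongr : ∫ s in (0 : ℝ)..x, (2 * ((WithLp.toLp 2 (((1 / 2 : ℝ) • a), b)).fst : ℝ → ℝ) s
        - prim (((WithLp.toLp 2 (((1 / 2 : ℝ) • a), b)).snd : W L) : ℝ → ℝ) s) = ∫ s in (0 : ℝ)..x, v 0 :=
      intervalIntegral.integral_congr_ae (hfst.mono fun s hs _ => by rw [hsnd, hprimb s, hs]; ring)
    rw [hcongr, intervalIntegral.integral_const, smul_eq_mul]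
    ring
  have hmem : WithLp.toLp 2 (((1 / 2 : ℝ) • a), b) ∈ EspE L hL := by
    rw [mem_EspE_iff]
    refine ⟨fun x => ?_, fun x => ?_, ?_⟩
    · rw [hI x, hI 1]; ring
    · rw [hsnd, hprimb, hprimb, heven]
    · rw [integral_congr_ae hfst, integral_const_mul, hz, mul_zero]
  refine ⟨⟨_, hmem⟩, ?_, ?_⟩
  · funext x
    have hbase : baseConst (⟨_, hmem⟩ : EspE L hL) = v 0 := by
      show ∫ s in (0 : ℝ)..1, (2 * ((WithLp.toLp 2 (((1 / 2 : ℝ) • a), b)).fst : ℝ → ℝ) s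
        - prim (((WithLp.toLp 2 (((1 / 2 : ℝ) • a), b)).snd : W L) : ℝ → ℝ) s) = v 0
      rw [hI 1, one_mul]
    show baseConst (⟨_, hmem⟩ : EspE L hL) + prim (((WithLp.toLp 2 (((1 / 2 : ℝ) • a), b)).snd : W L) : ℝ → ℝ) x = v x
    rw [hbase, hsnd, hprimb x]
    ring
  · show (((WithLp.toLp 2 (((1 / 2 : ℝ) • a), b)).snd : W L) : ℝ → ℝ) =ᵐ[volume] v₁
    rw [hsnd]; exact hae_b

/-- If `profile P = v` and `v X ≠ 0` for some `X`, then `P ≠ 0`. [folklore] -/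
theorem espE_ne_zero_of_apply_ne_zero (hL : 0 < L) {P : EspE L hL} {v : ℝ → ℝ} (hP : profile P = v) {X : ℝ} (hX : v X ≠ 0) :
    P ≠ 0 := by
  rintro rfl
  apply hX
  have e := (derE_smul hL (0 : ℝ) (0 : EspE L hL)).2
  rw [zero_smul] at e
  rw [← hP, e]
  exact zero_mul _

/-! ### §3 The covariant velocity of the translation mode: `∫_{(−∞,ξ]} H[Ω′] = HΩ(ξ)` -/

/-- **`𝒰⁺[Ω′](ξ) = ∫_{(−∞,ξ]} H[Ω′] = HΩ(ξ)`** for `Ω ∈ C³ ∩ L¹` in the decay class `|Ω″| ≤ M`, `|Ω′| ≤ C/(1+ξ²)` with `HΩ, H[Ω′] ∈ L¹`: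
`(HΩ)′ = H[Ω′]` (`SheetRTimeShiftMode.hasDerivAt_hilbertTransform_profile`), and an `L¹` function with `L¹` derivative tends to `0` at `−∞`
(Mathlib `tendsto_zero_of_hasDerivAt_of_integrableOn_Iic`, `integral_Iic_of_hasDerivAt_of_tendsto`). This is DESIGN-Z3-SR-SPEC-EVEN (D2)'s
«the covariant perturbation velocity of the translation mode is `HΩ`». [folklore] -/
theorem setIntegral_Iic_hilbertTransform_deriv {Ω : ℝ → ℝ} (hΩ : ContDiff ℝ 3 Ω) (hΩi : Integrable Ω) {M C : ℝ}
    (hM : ∀ y, |deriv (deriv Ω) y| ≤ M) (hC : ∀ y, |deriv Ω y| ≤ C / (1 + y ^ 2))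
    (hHi : Integrable (hilbertTransform Ω)) (hH'i : Integrable (hilbertTransform (deriv Ω))) (ξ : ℝ) :
    ∫ s in Iic ξ, hilbertTransform (deriv Ω) s = hilbertTransform Ω ξ := by
  have hder := SheetRTimeShiftMode.hasDerivAt_hilbertTransform_profile hΩ hΩi hM hC
  have htend : Tendsto (hilbertTransform Ω) atBot (𝓝 0) :=
    tendsto_zero_of_hasDerivAt_of_integrableOn_Iic (a := ξ) (fun x _ => hder x) hH'i.integrableOn hHi.integrableOn
  rw [integral_Iic_of_hasDerivAt_of_tendsto (hder ξ).continuousAt.continuousWithinAt (fun x _ => hder x) hH'i.integrableOn htend,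
    sub_zero]

/-! ### §4 Complex classes in `WcevenZ`, the real rank-one lift, real inner products -/

/-- **The complex class `ιEE P + 0·i ∈ WcevenZ` of an even energy-space element.** [folklore] -/
def cplxE (hL : 0 < L) (P : EspE L hL) : WcevenZ hL :=
  ⟨ofPair L (ιpairE hL (WithLp.toLp 2 (P, (0 : EspE L hL)))), ofPair_ιpairE_mem_WcevenZ hL _⟩

/-- The pair embedding of `(P, 0)` is `(ιEE P, 0)`. [folklore] -/
theorem ιpairE_toLp_zero (hL : 0 < L) (P : EspE L hL) :
    ιpairE hL (WithLp.toLp 2 (P, (0 : EspE L hL))) = WithLp.toLp 2 (ιEE hL P, (0 : W L)) := by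
  obtain ⟨h1, h2⟩ := ιpairE_fst_snd hL (WithLp.toLp 2 (P, (0 : EspE L hL)))
  refine WithLp.ofLp_injective 2 (Prod.ext ?_ ?_)
  · show (ιpairE hL (WithLp.toLp 2 (P, (0 : EspE L hL)))).fst = ιEE hL P
    rw [h1]; rfl
  · show (ιpairE hL (WithLp.toLp 2 (P, (0 : EspE L hL)))).snd = 0
    rw [h2]; exact map_zero (ιEE hL)

/-- `cplxE P = ofRealW (ιEE P)` and `toPair (cplxE P) = ιpairE (P, 0)`. [folklore] -/
theorem coe_cplxE (hL : 0 < L) (P : EspE L hL) :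
    (cplxE hL P : Wc L) = ofRealW L (ιEE hL P) ∧ toPair L (cplxE hL P : Wc L) = ιpairE hL (WithLp.toLp 2 (P, (0 : EspE L hL))) := by
  have h0 : (cplxE hL P : Wc L) = ofPair L (ιpairE hL (WithLp.toLp 2 (P, (0 : EspE L hL)))) := rfl
  refine ⟨?_, by rw [h0, toPair_ofPair]⟩
  rw [h0, ιpairE_toLp_zero, ofPair_apply]
  show ofRealW L (ιEE hL P) + (Complex.I : ℂ) • ofRealW L 0 = ofRealW L (ιEE hL P)
  rw [map_zero, smul_zero, add_zero]

/-- `P ≠ 0 ⇒ cplxE P ≠ 0` (the pivot embedding `ιEE` is injective, `eq_zero_of_ιEE_eq_zero`). [folklore] -/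
theorem cplxE_ne_zero (hL : 0 < L) {P : EspE L hL} (hP : P ≠ 0) : cplxE hL P ≠ 0 := by
  intro h0
  have h1 : (cplxE hL P : Wc L) = 0 := by rw [h0, Submodule.coe_zero]
  have h2 : ιEE hL P = 0 := by
    rw [← (reW_imW_ofRealW (L := L) (ιEE hL P)).1, ← (coe_cplxE hL P).1, h1, map_zero]
  exact hP (eq_zero_of_ιEE_eq_zero hL h2)

/-- **The complex class `g + 0·i ∈ WcevenZ` of a real even zero-mass `g ∈ WevenZ`** (the lift vector `h⁺` of record). [folklore] -/
def realE (hL : 0 < L) (g : W L) (hg : g ∈ WevenZ hL) : WcevenZ hL :=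
  ⟨ofRealW L g, by
    rw [mem_WcevenZ_iff, (reW_imW_ofRealW (L := L) g).1, (reW_imW_ofRealW (L := L) g).2]
    exact ⟨hg, Submodule.zero_mem _⟩⟩

/-- Coercion of `realE`. [folklore] -/
theorem coe_realE (hL : 0 < L) (g : W L) (hg : g ∈ WevenZ hL) : (realE hL g hg : Wc L) = ofRealW L g := rfl

/-- The real rank-one lift `F′ := (θ • (⟪h, ·⟫ ∘ ιEE)).smulRight f` acts as `F′ q = (θ·⟪h, ιEE q⟫)·f`. [folklore] -/
theorem rankOneLiftE_apply (hL : 0 < L) (hR fR : W L) (θ : ℝ) (q : EspE L hL) :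
    ((θ • ((innerSL ℝ hR).comp (ιEE hL))).smulRight fR) q = (θ * ⟪hR, ιEE hL q⟫_ℝ) • fR := by
  rw [ContinuousLinearMap.smulRight_apply, _root_.smul_apply, ContinuousLinearMap.comp_apply, innerSL_apply_apply, smul_eq_mul]

end SheetREvenEnergySpaceOf
end Summit.NavierStokesRegularity.OSWSelfSimilar

end
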